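import Literature.MathematicalPhysics.QuantumFieldTheory.Balaban1983to89.B8Ineq132

/-!
# `Balaban1983to89.B8Eq143PlaqExpansion` — B8 (1.21)/(1.22)/(1.26) and Sect. C (1.43)–(1.45): the covariant
# plaquette variable `∂_{U₀}U₁`, the expansion of `(U₁U₀)(∂p) − 1` and of its covariant divergence, with the
# printed constants `4`, `8d`, `2d`, `10d = 8d + 2d`

CITATION HEADER (lean-in-tree rule 2026-08-18).  Kernel certificate written by the B08 owner lineage
(`b2b-balaban-b08`, generation 23) of the audit cell `pub-balaban` for

* **B8** = T. Bałaban, *Spaces of regular gauge field configurations on a lattice and gauge fixing conditions*,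
  Commun. Math. Phys. **99** (1985) 75–102 [cite key `Balaban1985RegularSpaces`; printed page = PDF page + 74;
  renders READ AS IMAGES: `1985-cmp99-regular-spaces-gauge-fixing-p005/p009/p010-x2.png` and `-x4.png` = printed
  pp. 79, 83, 84; the carriers (1.1)/(1.2) of p. 76 are those certified in `B8Ineq132`],

on top of the tree's carriers: the plaquette field `B8Ineq132.plaqF` (`U(∂p_{μν}(x))`), the backward covariant
derivative `B8Ineq132.covDeriv` = (1.1) and the covariant divergence `B8Ineq132.covDiv` = (1.2), the bondwise
product configuration `B8Lemma1NonAbelian.mulCfg` = (1.21) («U = U′U₀»), the conjugation `B7Eq78Linearization.conjR`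
= `R(U)X = UXU⁻¹`, the holonomy (9) / plaquette contour (44) of [3] (`B7Prop1Explicit.hol`, `plaqWord`,
`B7Prop1Local.hol_plaqWord_eq`).  Nothing in this module is cited FROM the manuscript as a fact: the displayed
formula (1.22) enters only as the DEFINITION of `∂_{U₀}U′` (`covPlaq` below), and every `theorem` is kernel-proved —
the ABSOLUTE RULE of the cell (no internally-minted statement enters as a cited fact; the manuscript under audit is
not citable for its own steps).

## The printed texts (verbatim, from the renders)

* p. 76 [PDF 2], (1.1)–(1.2) (the carriers; quoted in full in `B8Ineq132`): «(D^{η*}_{U,μ}F)(x) =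
  η⁻¹(R(U(x, x − ηe_μ))F(x − ηe_μ) − F(x)), (1.1) where U is an arbitrary gauge field configuration, and
  R(U)X = UXU⁻¹ … p_{μν}(x) = ⟨x, x + ηe_μ, x + ηe_μ + ηe_ν, x + ηe_ν⟩, and let F_{μν}(x) = F(p_{μν}(x)). We define
  (D^{η*}_U F)(x, x + ηe_μ) = (D^{η*}_U F)_μ(x) = Σ_{ν<μ}(D^{η*}_{U,ν}F_{νμ})(x) − Σ_{ν>μ}(D^{η*}_{U,ν}F_{μν})(x). (1.2)».
* p. 79 [PDF 5]: «Let us analyze it for k = 1. More exactly we want to understand implications of (1.19) and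
  (1.7). We have for a plaquette p = ⟨x, y, z, w⟩
  U(∂p) = (U′U₀)(∂p) = U′(x, y)R(U₀(x, y))U′(y, z)U₀(∂p)R(U₀(x, w))U′(z, w)U′(w, x), (1.21)
  and let us denote  (∂_{U₀}U′)(p) = U′(x, y)R(U₀(x, y))U′(z, y)R(U₀(x, w))U′(z, w)U′(w, x). (1.22)» … «We will
  prove the lemma. From (1.22) and the assumptions we have
  |(∂_{V₀}V′)(p) − 1| ≦ |V₀(∂p) − 1| + |(V′V₀)(∂p) − 1| < 2α₀L⁻². (1.26)».
* p. 83 [PDF 9]: «Let us consider a somewhat more general situation. We assume that we have configurations U₀,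
  U₁U₀ satisfying the following conditions  U₀, U₁U₀ ∈ 𝔄_k({Ω_j}, α₀), U₀ satisfies the additional regularity
  condition (3.35) in [4], (1.40)  U₁ = e^{iηA}, |A| < α₂(Lʲη)⁻¹ on Ω_j, (1.41)  R(U₀)D^{η*}_{U₀}A = 0,
  Q_j(U₀, ηA) = B on Λ_j, |B| < 2dLα₁, (1.42) (j = 0, 1, …, k above).» … «We derive formulas and estimates which
  will have other applications in the future, so we formulate them now in the most general way needed. We have
  from (1.21), (1.22),
  (U₁U₀)(∂p) − 1 = [U₁(x, y)R(U₀(x, y))U₁(y, z) − 1][U₀(∂p) − 1]·R(U₀(x, w))U₁(z, w)U₁(w, x)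
    + [U₀(∂p) − 1][R(U₀(x, w))U₁(z, w)U₁(w, x) − 1] + [U₀(∂p) − 1] + [(∂_{U₀}U₁)(p) − 1]. (1.43)».
* p. 84 [PDF 10]: «The first two terms on the right-hand side can be bounded by 4α₂α₀(Lʲη)⁻³η³ for p ⊂ Ω_j. If we
  apply the derivative D^{η*}_{U₁U₀} to ∂U₁U₀, then the derivative of these two terms can be bounded by
  8dα₂α₀(Lʲη)⁻³η². Further we have  |D^{η*}_{U₁U₀}∂U₀ − D^{η*}_{U₀}∂U₀| < 2dα₀α₂(Lʲη)⁻³η²  on Ω_j.  Let us denote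
  by O₁(α) an expression which can be estimated by α, i.e. |O₁(α)| ≦ α. Thus we have
  D^{η*}_{U₁U₀}∂U₁U₀ = D^{η*}_{U₀}∂U₀ + D^{η*}_{U₁U₀}∂_{U₀}U₁ + O₁(10dα₀α₂(Lʲη)⁻³η²). (1.44)
  Let us consider the second term on the right-hand side above. From the definition (1.1), (1.2) we obtain that a
  value of this expression at a bond ⟨x, x + ηe_μ⟩ ∈ Ω_j is equal to
  (D^{η*}_{U₁U₀}∂_{U₀}U₁)(x, x + ηe_μ) = (D^{η*}_{U₁U₀}(∂_{U₀}U₁ − 1))(x, x + ηe_μ)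
   = (D^{η*}_{U₀}(∂_{U₀}U₁ − 1))(x, x + ηe_μ)
   + Σ_{ν<μ} η⁻¹R(U₀(x, x − ηe_ν))·(R(U₁(x, x − ηe_ν)) − 1)((∂_{U₀}U₁)(p_{νμ}(x − ηe_ν)) − 1)
   − Σ_{ν>μ} η⁻¹R(U₀(x, x − ηe_ν))(R(U₁(x, x − ηe_ν)) − 1)((∂_{U₀}U₁)(p_{μν}(x − ηe_ν)) − 1). (1.45)
  We expand R(U₁(x, x − ηe_ν)) − 1 in A. Because ∂_{U₀}U₁ − 1 = O₁(4α₂(Lʲη)⁻¹η), so it is enough to consider a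
  term of the first order, …».

## Dictionary (the `ℤ^d` model of `B7Prop1Explicit` / `B8Ineq132`, header DICTIONARY there)

Sites `Site d = Fin d → ℤ` (lattice spacing carried by the explicit `η > 0` of (1.1)), bond fields
`Site d → Fin d → 𝔸ˣ` over a normed ring / complete normed `ℂ`-algebra `𝔸` with `‖1‖ = 1` (so `M_N(ℂ)`), the
gauge group abstracted to `U1 𝔸 = {u : ‖u‖ ≤ 1, ‖u⁻¹‖ ≤ 1}` (contains `U(N)`); `U(x, x − e_ν) = U(x − e_ν, x)⁻¹`
((9) of [3]).  For the plaquette `p = p_{μν}(x) = ⟨x, y, z, w⟩`, `y = x + e_μ`, `z = x + e_μ + e_ν`, `w = x + e_ν`: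
* `U(∂p)` ↦ `plaqF U μ ν x = U(x,μ)U(x+e_μ,ν)U(x+e_ν,μ)⁻¹U(x,ν)⁻¹` (`U(z, w) = U(w, z)⁻¹`, `U(w, x) = U(x, w)⁻¹`);
* `U′U₀` ↦ `mulCfg U' U₀` (`(U′U₀)_b = U′_b U₀,b` on positively oriented bonds);
* `U′(x, y)R(U₀(x, y))U′(y, z)` ↦ `lead U₀ U' μ ν x`,  `R(U₀(x, w))U′(z, w)U′(w, x)` ↦ `trail U₀ U' μ ν x`,
  `(∂_{U₀}U′)(p)` ↦ **`covPlaq U₀ U' μ ν x = lead · trail`** (group-valued; `covPlaqF` its `𝔸`-valued plaquette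
  function);
* `D^{η*}_{U,ν}` ↦ `covDeriv η U ν`, `(D^{η*}_U F)_μ(x)` for a GENERAL plaquette function `F` ↦ **`pdiv η U F μ x`**
  (so that `D^{η*}_U ∂U = pdiv η U (plaqF U) = covDiv η U`, `pdiv_plaqF`), the `ν`-th summand of the correction in
  (1.45) ↦ `corr η U₀ U₁ ν G x`;  the first two terms of (1.43) ↦ `rem43 U₀ U₁ μ ν x`;
* smallness: `|U₁ − 1| ≤ u` on bonds ↦ `hu`, `|U₀(∂p) − 1| ≤ p` on plaquettes ↦ `hp`; print's values are
  `u = α₂(Lʲη)⁻¹η` (from (1.41), `U₁ = e^{iηA}`, `|A| < α₂(Lʲη)⁻¹`, dropping the `e^{O(ηα₂(Lʲη)⁻¹)}` factor as print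
  does) and `p = α₀η²(Lʲη)⁻²` ((1.8) ⟺ (1.7), `B8Ineq132.threshold_18`).

## What is certified (kernel, `sorry`-free; axioms `propext` / `Classical.choice` / `Quot.sound`)

§1 **(1.21)** as an identity in an arbitrary group (`hol_plaqWord_mulCfg`) and for `plaqF` (`eq121`); (1.22) =
`covPlaq` with `lead = U′(x,y)R(U₀(x,y))U′(y,z)`, `trail = R(U₀(x,w))U′(z,w)U′(w,x)` spelled through `conjR`
(`val_lead`, `val_trail`); **(1.43)** (`eq143`, pointwise, and `eq143_fun`, as an identity of plaquette
functions) — a free-ring identity (`ring_identity_143`) on top of (1.21).  §2 for `U1`-valued fields: **(1.26)**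
(`ineq126`) and «∂_{U₀}U₁ − 1 = O₁(4α₂(Lʲη)⁻¹η)» (`norm_covPlaq_sub_one_le`, `norm_covPlaq_sub_one_le_four`: `≤ 4u`);
«the first two terms … can be bounded by 4α₂α₀(Lʲη)⁻³η³»: `norm_rem43_le` (`≤ 4up`, from `|lead − 1|,
|trail − 1| ≤ 2u`, `|trail| ≤ 1`) and `norm_rem43_le_printed`.  §3 the divergence (1.2) of a general plaquette
function (`pdiv`; `pdiv_plaqF : pdiv η U (plaqF U) = covDiv η U` by `rfl`), its additivity (`covDeriv_add`,
`pdiv_add`), «(D^{η*}_{U₁U₀}∂_{U₀}U₁) = (D^{η*}_{U₁U₀}(∂_{U₀}U₁ − 1))» (constants are covariantly constant: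
`covDeriv_sub_one`, `pdiv_sub_one`), **(1.45)** as an EXACT identity for every plaquette function
(`covDeriv_mulCfg`, `eq145`, `eq145_covPlaq`): `R((U₁U₀)(x, x − e_ν)) = R(U₀(x, x − e_ν))R(U₁(x, x − e_ν))`, and
(1.44) before estimation (`eq144_identity`: `D^{η*}_{U₁U₀}` applied to (1.43); `pdiv_plaqF_sub_covDiv`).
§4 the bounds, for `U1`-valued `U₀, U₁` with `|U₁ − 1| ≤ u` on all bonds and `|U₀(∂p) − 1| ≤ p` on all
plaquettes, `η > 0`: `|D^{η*}_{U,ν}G(x)| ≤ η⁻¹(|G(x − e_ν)| + |G(x)|)` (`norm_covDeriv_le`), `|R(w)Z − Z| ≤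
2|w − 1||Z|` (`norm_conjR_sub_self_le`, §2), `|corr| ≤ η⁻¹·2|U₁(b) − 1||G − 1|` (`norm_corr_le`); «the derivative
of these two terms can be bounded by 8d…»: `norm_pdiv_rem43_le` (`≤ 8(d−1)η⁻¹up`); «|D^{η*}_{U₁U₀}∂U₀ −
D^{η*}_{U₀}∂U₀| < 2d…»: `norm_pdiv_plaqF_sub_covDiv_le` (`≤ 2(d−1)η⁻¹up`); **(1.44)**: `eq144` —
`|D^{η*}_{U₁U₀}∂(U₁U₀) − D^{η*}_{U₀}∂U₀ − D^{η*}_{U₁U₀}∂_{U₀}U₁| ≤ 10(d−1)η⁻¹up` at every bond; and the same bounds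
in print's units (`units_p84`; `norm_pdiv_rem43_le_printed`: `8dα₀α₂(Lʲη)⁻³η²`,
`norm_pdiv_plaqF_sub_covDiv_le_printed`: `2dα₀α₂(Lʲη)⁻³η²`, `eq144_printed`: `10dα₀α₂(Lʲη)⁻³η²`).
So the constants `4`, `8d`, `2d`, `10d = 8d + 2d` of p. 84 — hand-certified in the cell's census (GAPS C-B8-10) —
are now KERNEL facts of the model, with `d − 1` (the number of directions `ν ≠ μ` in (1.2)) in place of print's
`d` at the divergence level (`(d − 1)·t ≤ d·t` for `t ≥ 0`).

## HONEST SCOPE — what is NOT claimed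

(i) Print's (1.22) has the factor «U′(z, y)»; by (1.21), by (1.43) (whose last bracket must equal `lead·trail − 1`
for the identity to hold — it is kernel-checked here in that reading) and by the sibling quotation in
`B8Lemma1Lattice`, the factor is `U′(y, z)`; we formalise `U′(y, z)` and record the print slip (DIVERGENCE D-b08-g23.1).
(ii) The smallness hypotheses are taken GLOBALLY (all bonds / all plaquettes) where print localises to `Ω_j`
(«for p ⊂ Ω_j», «on Ω_j»); the pointwise lemmas (`norm_rem43_le`, `norm_corr_le`, the exact identities (1.43),
(1.45)) carry the locality, the region bookkeeping of (1.3)–(1.5) is not repeated (cf. `B8Ineq132.covDiv_congr`).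
(iii) `|U₁ − 1| ≤ u` is a hypothesis on `U₁` itself; print's `u = α₂(Lʲη)⁻¹η` from (1.41) drops the factor
`e^{ηα₂(Lʲη)⁻¹}` of `|e^{iηA} − 1| ≤ e^{η|A|} − 1` (as everywhere in B8 Sect. C; census class remark of C-B8-10) — the
`_printed` corollaries therefore ASSUME `|U₁ − 1| ≤ α₂(Lʲη)⁻¹η` rather than derive it from `|A| < α₂(Lʲη)⁻¹`.
(iv) Print's strict `<` are certified as `≤` from `≤`-hypotheses (formally stronger conclusions).  (v) The
`A`-expansions (1.46)–(1.48) (remainders `3α₂²`, `8α₂²`, `28d`, `4³/3·d`) are NOT typed here.  (vi) Nothing here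
is progress on the summit `Summit.QuantumFields` — the value is a kernel section certificate for B8 (1.21)–(1.22),
(1.26), (1.43)–(1.45).
-/

noncomputable section

open scoped BigOperators
open NormedSpace Finset

namespace Literature.MathematicalPhysics.QuantumFieldTheory.Balaban1983to89.B8Eq143PlaqExpansion

open B7Prop1Explicit
open B7Prop1Local (hol_plaqWord_eq)
open B7Eq78Linearization (conjR conjR_apply conjR_one conjR_add conjR_sub conjR_smul_real)
open B8Lemma1NonAbelian (mulCfg norm_units_mul_sub_one_le)
open B8Ineq132 (plaqF covDeriv covDiv conjR_conjR one_conjR conjR_sum conjR_units norm_conjR_le norm_conjR)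

-- `Site` alone would resolve to the torus sites of `Setup.lean`; re-export the `ℤ^d` sites of `B7Prop1Explicit`.
export B7Prop1Explicit (Site)

variable {d : ℕ}

/-! ## §1 (1.21), (1.22), (1.43): the factorisation of `(U′U₀)(∂p)`, the covariant plaquette variable `∂_{U₀}U′`
and the expansion of `(U₁U₀)(∂p) − 1` -/

section GroupLevel

variable {G : Type*} [Group G]

/-- `U′(x, y)R(U₀(x, y))U′(y, z)` for `p_{μν}(x) = ⟨x, y, z, w⟩`, `y = x + e_μ`, `z = y + e_ν`: the leading factor of
(1.21)/(1.22), `R(g)h = ghg⁻¹`. [cite: Balaban1985RegularSpaces, (1.21)-(1.22) p.79] -/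
def lead (U₀ U' : Site d → Fin d → G) (μ ν : Fin d) (x : Site d) : G :=
  U' x μ * (U₀ x μ * U' (x + e μ) ν * (U₀ x μ)⁻¹)

/-- `R(U₀(x, w))U′(z, w)·U′(w, x)` for `p_{μν}(x) = ⟨x, y, z, w⟩`, `w = x + e_ν`, with `U′(z, w) = U′(w, z)⁻¹`,
`U′(w, x) = U′(x, w)⁻¹` ((9) of [3]): the trailing factor of (1.21)/(1.22).
[cite: Balaban1985RegularSpaces, (1.21)-(1.22) p.79] -/
def trail (U₀ U' : Site d → Fin d → G) (μ ν : Fin d) (x : Site d) : G :=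
  U₀ x ν * (U' (x + e ν) μ)⁻¹ * (U₀ x ν)⁻¹ * (U' x ν)⁻¹

/-- **(1.22)** THE COVARIANT PLAQUETTE VARIABLE `(∂_{U₀}U′)(p) = U′(x, y)R(U₀(x, y))U′(y, z)R(U₀(x, w))U′(z, w)U′(w, x)`
(print: «U′(z, y)», a slip for `U′(y, z)`, see HONEST SCOPE (i)). [cite: Balaban1985RegularSpaces, (1.22) p.79] -/
def covPlaq (U₀ U' : Site d → Fin d → G) (μ ν : Fin d) (x : Site d) : G :=
  lead U₀ U' μ ν x * trail U₀ U' μ ν x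

/-- **(1.21)** in an arbitrary group: `(U′U₀)(∂p) = [U′(x,y)R(U₀(x,y))U′(y,z)]·U₀(∂p)·[R(U₀(x,w))U′(z,w)U′(w,x)]`.
[cite: Balaban1985RegularSpaces, (1.21) p.79] -/
theorem hol_plaqWord_mulCfg (U₀ U' : Site d → Fin d → G) (μ ν : Fin d) (x : Site d) :
    hol (mulCfg U' U₀) x (plaqWord μ ν) = lead U₀ U' μ ν x * hol U₀ x (plaqWord μ ν) * trail U₀ U' μ ν x := by
  simp only [hol_plaqWord_eq, lead, trail, mulCfg]
  group

end GroupLevel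

section Algebra

variable {𝔸 : Type*} [NormedRing 𝔸]

/-- The plaquette field spelled out: `U(∂p_{μν}(x)) = U(x,μ)U(x+e_μ,ν)U(x+e_ν,μ)⁻¹U(x,ν)⁻¹`.
[cite: Balaban1985Averaging, (9), (44) pp.18, 24] -/
theorem plaqF_eq (V : Site d → Fin d → 𝔸ˣ) (μ ν : Fin d) (x : Site d) :
    plaqF V μ ν x = ((V x μ * V (x + e μ) ν * (V (x + e ν) μ)⁻¹ * (V x ν)⁻¹ : 𝔸ˣ) : 𝔸) := by
  simp only [plaqF, hol_plaqWord_eq]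

/-- `lead` through print's `R(·)`: `U′(x, y)·R(U₀(x, y))U′(y, z)`. [cite: Balaban1985RegularSpaces, (1.21) p.79] -/
theorem val_lead (U₀ U' : Site d → Fin d → 𝔸ˣ) (μ ν : Fin d) (x : Site d) :
    ((lead U₀ U' μ ν x : 𝔸ˣ) : 𝔸) = (U' x μ : 𝔸) * conjR (U₀ x μ) (U' (x + e μ) ν : 𝔸) := by
  simp only [lead, Units.val_mul, conjR_apply, mul_assoc]

/-- `trail` through print's `R(·)`: `R(U₀(x, w))U′(z, w) · U′(w, x)`. [cite: Balaban1985RegularSpaces, (1.21) p.79] -/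
theorem val_trail (U₀ U' : Site d → Fin d → 𝔸ˣ) (μ ν : Fin d) (x : Site d) :
    ((trail U₀ U' μ ν x : 𝔸ˣ) : 𝔸) = conjR (U₀ x ν) (((U' (x + e ν) μ)⁻¹ : 𝔸ˣ) : 𝔸) * (((U' x ν)⁻¹ : 𝔸ˣ) : 𝔸) := by
  simp only [trail, Units.val_mul, conjR_apply]

/-- **(1.21)** for the plaquette field: `(U′U₀)(∂p) = lead · U₀(∂p) · trail`.
[cite: Balaban1985RegularSpaces, (1.21) p.79] -/
theorem eq121 (U₀ U' : Site d → Fin d → 𝔸ˣ) (μ ν : Fin d) (x : Site d) :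
    plaqF (mulCfg U' U₀) μ ν x = ((lead U₀ U' μ ν x : 𝔸ˣ) : 𝔸) * plaqF U₀ μ ν x * ((trail U₀ U' μ ν x : 𝔸ˣ) : 𝔸) := by
  simp only [plaqF, hol_plaqWord_mulCfg, Units.val_mul]

/-- The `𝔸`-valued plaquette function `p_{μν}(x) ↦ (∂_{U₀}U₁)(p_{μν}(x))`.
[cite: Balaban1985RegularSpaces, (1.22) p.79, (1.44) p.84] -/
def covPlaqF (U₀ U₁ : Site d → Fin d → 𝔸ˣ) : Fin d → Fin d → Site d → 𝔸 :=
  fun μ ν x => ((covPlaq U₀ U₁ μ ν x : 𝔸ˣ) : 𝔸)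

/-- THE FIRST TWO TERMS OF (1.43):
`[U₁(x,y)R(U₀(x,y))U₁(y,z) − 1][U₀(∂p) − 1]·R(U₀(x,w))U₁(z,w)U₁(w,x) + [U₀(∂p) − 1][R(U₀(x,w))U₁(z,w)U₁(w,x) − 1]`.
[cite: Balaban1985RegularSpaces, (1.43) p.83] -/
def rem43 (U₀ U₁ : Site d → Fin d → 𝔸ˣ) (μ ν : Fin d) (x : Site d) : 𝔸 :=
  (((lead U₀ U₁ μ ν x : 𝔸ˣ) : 𝔸) - 1) * (plaqF U₀ μ ν x - 1) * ((trail U₀ U₁ μ ν x : 𝔸ˣ) : 𝔸)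
    + (plaqF U₀ μ ν x - 1) * (((trail U₀ U₁ μ ν x : 𝔸ˣ) : 𝔸) - 1)

/-- The free-ring identity behind (1.43): `aPc − 1 = (a − 1)(P − 1)c + (P − 1)(c − 1) + (P − 1) + (ac − 1)`. [folklore] -/
theorem ring_identity_143 (a P c : 𝔸) :
    a * P * c - 1 = (a - 1) * (P - 1) * c + (P - 1) * (c - 1) + (P - 1) + (a * c - 1) := by
  noncomm_ring

/-- **(1.43)**: `(U₁U₀)(∂p) − 1 = [lead − 1][U₀(∂p) − 1]·trail + [U₀(∂p) − 1][trail − 1] + [U₀(∂p) − 1]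
+ [(∂_{U₀}U₁)(p) − 1]`. [cite: Balaban1985RegularSpaces, (1.43) p.83] -/
theorem eq143 (U₀ U₁ : Site d → Fin d → 𝔸ˣ) (μ ν : Fin d) (x : Site d) :
    plaqF (mulCfg U₁ U₀) μ ν x - 1 =
      (((lead U₀ U₁ μ ν x : 𝔸ˣ) : 𝔸) - 1) * (plaqF U₀ μ ν x - 1) * ((trail U₀ U₁ μ ν x : 𝔸ˣ) : 𝔸)
        + (plaqF U₀ μ ν x - 1) * (((trail U₀ U₁ μ ν x : 𝔸ˣ) : 𝔸) - 1) + (plaqF U₀ μ ν x - 1)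
        + (((covPlaq U₀ U₁ μ ν x : 𝔸ˣ) : 𝔸) - 1) := by
  rw [eq121, covPlaq, Units.val_mul]
  exact ring_identity_143 _ _ _

/-- **(1.43)** as an identity of plaquette functions: `∂(U₁U₀) − 1 = rem43 + (∂U₀ − 1) + (∂_{U₀}U₁ − 1)`.
[cite: Balaban1985RegularSpaces, (1.43) p.83] -/
theorem eq143_fun (U₀ U₁ : Site d → Fin d → 𝔸ˣ) :
    plaqF (mulCfg U₁ U₀) - 1 = rem43 U₀ U₁ + (plaqF U₀ - 1) + (covPlaqF U₀ U₁ - 1) := by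
  funext μ ν x
  simp only [Pi.add_apply, Pi.sub_apply, Pi.one_apply, rem43, covPlaqF]
  exact eq143 U₀ U₁ μ ν x

/-- The shape of «the first two terms … can be bounded by 4α₂α₀(Lʲη)⁻³η³»:
`|(a − 1)(P − 1)c + (P − 1)(c − 1)| ≤ 4up` for `|a − 1|, |c − 1| ≤ 2u`, `|c| ≤ 1`, `|P − 1| ≤ p`. [folklore] -/
theorem norm_two_terms_le {a P c : 𝔸} {u p : ℝ} (ha : ‖a - 1‖ ≤ 2 * u) (hc : ‖c - 1‖ ≤ 2 * u)
    (hc1 : ‖c‖ ≤ 1) (hP : ‖P - 1‖ ≤ p) :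
    ‖(a - 1) * (P - 1) * c + (P - 1) * (c - 1)‖ ≤ 4 * u * p := by
  have hp : 0 ≤ p := (norm_nonneg _).trans hP
  have hu : 0 ≤ 2 * u := (norm_nonneg _).trans ha
  have h1 : ‖(a - 1) * (P - 1) * c‖ ≤ 2 * u * p * 1 :=
    norm_mul₃_le.trans (mul_le_mul (mul_le_mul ha hP (norm_nonneg _) hu) hc1 (norm_nonneg _) (mul_nonneg hu hp))
  have h2 : ‖(P - 1) * (c - 1)‖ ≤ p * (2 * u) :=
    (norm_mul_le _ _).trans (mul_le_mul hP hc (norm_nonneg _) hp)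
  calc ‖(a - 1) * (P - 1) * c + (P - 1) * (c - 1)‖
      ≤ ‖(a - 1) * (P - 1) * c‖ + ‖(P - 1) * (c - 1)‖ := norm_add_le _ _
    _ ≤ 2 * u * p * 1 + p * (2 * u) := add_le_add h1 h2
    _ = 4 * u * p := by ring

/-- `|Σ_{ν<μ} f_ν − Σ_{ν>μ} g_ν| ≤ (d − 1)t` if every summand has norm `≤ t` (there are `d − 1` directions `ν ≠ μ`).
[folklore] -/
theorem norm_sub_sums_le {μ : Fin d} {f g : Fin d → 𝔸} {t : ℝ} (hf : ∀ ν ∈ Finset.Iio μ, ‖f ν‖ ≤ t)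
    (hg : ∀ ν ∈ Finset.Ioi μ, ‖g ν‖ ≤ t) :
    ‖∑ ν ∈ Finset.Iio μ, f ν - ∑ ν ∈ Finset.Ioi μ, g ν‖ ≤ ((d : ℝ) - 1) * t := by
  have hcard : ((Finset.Iio μ).card : ℝ) + ((Finset.Ioi μ).card : ℝ) = (d : ℝ) - 1 := by
    have h3 : (μ : ℕ) < d := μ.isLt
    have hsum : (Finset.Iio μ).card + (Finset.Ioi μ).card + 1 = d := by
      rw [Fin.card_Iio, Fin.card_Ioi]; omega
    have hsum' : ((Finset.Iio μ).card : ℝ) + ((Finset.Ioi μ).card : ℝ) + 1 = (d : ℝ) := by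
      exact_mod_cast hsum
    linarith
  calc ‖∑ ν ∈ Finset.Iio μ, f ν - ∑ ν ∈ Finset.Ioi μ, g ν‖
      ≤ ‖∑ ν ∈ Finset.Iio μ, f ν‖ + ‖∑ ν ∈ Finset.Ioi μ, g ν‖ := norm_sub_le _ _
    _ ≤ ∑ ν ∈ Finset.Iio μ, t + ∑ ν ∈ Finset.Ioi μ, t :=
        add_le_add (norm_sum_le_of_le _ hf) (norm_sum_le_of_le _ hg)
    _ = ((d : ℝ) - 1) * t := by
        rw [Finset.sum_const, Finset.sum_const, nsmul_eq_mul, nsmul_eq_mul, ← add_mul, hcard]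

end Algebra

/-! ## §2 `U1`-valued fields: (1.26), `|∂_{U₀}U₁ − 1| ≤ 4u`, `|rem43| ≤ 4up` -/

section Normed

variable {𝔸 : Type*} [NormedRing 𝔸] [NormOneClass 𝔸]

/-- `(U₁U₀)_b ∈ U1`. [folklore] -/
theorem mulCfg_mem {U₀ U₁ : Site d → Fin d → 𝔸ˣ} (h₀ : ∀ y κ, U₀ y κ ∈ U1 𝔸) (h₁ : ∀ y κ, U₁ y κ ∈ U1 𝔸)
    (y : Site d) (κ : Fin d) : mulCfg U₁ U₀ y κ ∈ U1 𝔸 := by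
  show U₁ y κ * U₀ y κ ∈ U1 𝔸
  exact (U1 𝔸).mul_mem (h₁ y κ) (h₀ y κ)

/-- `lead ∈ U1`. [folklore] -/
theorem lead_mem {U₀ U' : Site d → Fin d → 𝔸ˣ} (h₀ : ∀ y κ, U₀ y κ ∈ U1 𝔸) (h' : ∀ y κ, U' y κ ∈ U1 𝔸)
    (μ ν : Fin d) (x : Site d) : lead U₀ U' μ ν x ∈ U1 𝔸 := by
  unfold lead
  exact (U1 𝔸).mul_mem (h' _ _)
    ((U1 𝔸).mul_mem ((U1 𝔸).mul_mem (h₀ _ _) (h' _ _)) ((U1 𝔸).inv_mem (h₀ _ _)))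

/-- `trail ∈ U1`. [folklore] -/
theorem trail_mem {U₀ U' : Site d → Fin d → 𝔸ˣ} (h₀ : ∀ y κ, U₀ y κ ∈ U1 𝔸) (h' : ∀ y κ, U' y κ ∈ U1 𝔸)
    (μ ν : Fin d) (x : Site d) : trail U₀ U' μ ν x ∈ U1 𝔸 := by
  unfold trail
  exact (U1 𝔸).mul_mem ((U1 𝔸).mul_mem ((U1 𝔸).mul_mem (h₀ _ _) ((U1 𝔸).inv_mem (h' _ _)))
    ((U1 𝔸).inv_mem (h₀ _ _))) ((U1 𝔸).inv_mem (h' _ _))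

/-- `∂_{U₀}U′ ∈ U1`. [folklore] -/
theorem covPlaq_mem {U₀ U' : Site d → Fin d → 𝔸ˣ} (h₀ : ∀ y κ, U₀ y κ ∈ U1 𝔸) (h' : ∀ y κ, U' y κ ∈ U1 𝔸)
    (μ ν : Fin d) (x : Site d) : covPlaq U₀ U' μ ν x ∈ U1 𝔸 :=
  (U1 𝔸).mul_mem (lead_mem h₀ h' μ ν x) (trail_mem h₀ h' μ ν x)

/-- `|U′(x,y)R(U₀(x,y))U′(y,z) − 1| ≤ |U′(x,y) − 1| + |U′(y,z) − 1|` (`R(·)` is conjugation by a `U1` element).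
[cite: Balaban1985RegularSpaces, p.84 ("∂_{U₀}U₁ − 1 = O₁(4α₂(Lʲη)⁻¹η)")] -/
theorem norm_lead_sub_one_le {U₀ U' : Site d → Fin d → 𝔸ˣ} {μ : Fin d} {x : Site d} (h₀ : U₀ x μ ∈ U1 𝔸)
    (h' : U' x μ ∈ U1 𝔸) (ν : Fin d) :
    ‖((lead U₀ U' μ ν x : 𝔸ˣ) : 𝔸) - 1‖ ≤ ‖(U' x μ : 𝔸) - 1‖ + ‖(U' (x + e μ) ν : 𝔸) - 1‖ := by
  unfold lead
  refine (norm_units_mul_sub_one_le h').trans (add_le_add le_rfl ?_)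
  rw [Units.val_mul, Units.val_mul]
  exact norm_units_conj_sub_one_le h₀ _

/-- `|R(U₀(x,w))U′(z,w)U′(w,x) − 1| ≤ |U′(w,z) − 1| + |U′(x,w) − 1|` (`|u⁻¹ − 1| ≤ |u − 1|` on `U1`).
[cite: Balaban1985RegularSpaces, p.84 ("∂_{U₀}U₁ − 1 = O₁(4α₂(Lʲη)⁻¹η)")] -/
theorem norm_trail_sub_one_le {U₀ U' : Site d → Fin d → 𝔸ˣ} {μ ν : Fin d} {x : Site d} (h₀ : U₀ x ν ∈ U1 𝔸)
    (h₁ : U' (x + e ν) μ ∈ U1 𝔸) (h₂ : U' x ν ∈ U1 𝔸) :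
    ‖((trail U₀ U' μ ν x : 𝔸ˣ) : 𝔸) - 1‖ ≤ ‖(U' (x + e ν) μ : 𝔸) - 1‖ + ‖(U' x ν : 𝔸) - 1‖ := by
  unfold trail
  have hq : U₀ x ν * (U' (x + e ν) μ)⁻¹ * (U₀ x ν)⁻¹ ∈ U1 𝔸 :=
    (U1 𝔸).mul_mem ((U1 𝔸).mul_mem h₀ ((U1 𝔸).inv_mem h₁)) ((U1 𝔸).inv_mem h₀)
  refine (norm_units_mul_sub_one_le hq).trans (add_le_add ?_ (norm_inv_sub_one_le h₂))
  rw [Units.val_mul, Units.val_mul]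
  exact (norm_units_conj_sub_one_le h₀ _).trans (norm_inv_sub_one_le h₁)

/-- `|(∂_{U₀}U′)(p) − 1| ≤` the sum of the four bond deviations `|U′_b − 1|`, `b ⊂ ∂p`.
[cite: Balaban1985RegularSpaces, p.84 ("∂_{U₀}U₁ − 1 = O₁(4α₂(Lʲη)⁻¹η)")] -/
theorem norm_covPlaq_sub_one_le {U₀ U' : Site d → Fin d → 𝔸ˣ} (h₀ : ∀ y κ, U₀ y κ ∈ U1 𝔸)
    (h' : ∀ y κ, U' y κ ∈ U1 𝔸) (μ ν : Fin d) (x : Site d) :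
    ‖((covPlaq U₀ U' μ ν x : 𝔸ˣ) : 𝔸) - 1‖ ≤
      (‖(U' x μ : 𝔸) - 1‖ + ‖(U' (x + e μ) ν : 𝔸) - 1‖) + (‖(U' (x + e ν) μ : 𝔸) - 1‖ + ‖(U' x ν : 𝔸) - 1‖) := by
  unfold covPlaq
  exact (norm_units_mul_sub_one_le (lead_mem h₀ h' μ ν x)).trans
    (add_le_add (norm_lead_sub_one_le (h₀ x μ) (h' x μ) ν) (norm_trail_sub_one_le (h₀ x ν) (h' _ _) (h' _ _)))

/-- «∂_{U₀}U₁ − 1 = O₁(4α₂(Lʲη)⁻¹η)» (p. 84): `|(∂_{U₀}U₁)(p) − 1| ≤ 4u` if `|U₁ − 1| ≤ u` on the bonds.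
[cite: Balaban1985RegularSpaces, p.84] -/
theorem norm_covPlaq_sub_one_le_four {U₀ U₁ : Site d → Fin d → 𝔸ˣ} (h₀ : ∀ y κ, U₀ y κ ∈ U1 𝔸)
    (h₁ : ∀ y κ, U₁ y κ ∈ U1 𝔸) {u : ℝ} (hu : ∀ y κ, ‖(U₁ y κ : 𝔸) - 1‖ ≤ u) (μ ν : Fin d) (x : Site d) :
    ‖((covPlaq U₀ U₁ μ ν x : 𝔸ˣ) : 𝔸) - 1‖ ≤ 4 * u := by
  refine (norm_covPlaq_sub_one_le h₀ h₁ μ ν x).trans ?_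
  have := hu x μ; have := hu (x + e μ) ν; have := hu (x + e ν) μ; have := hu x ν
  linarith

/-- **(1.26)**: `|(∂_{V₀}V′)(p) − 1| ≦ |V₀(∂p) − 1| + |(V′V₀)(∂p) − 1|` for `U1`-valued `V₀`, `V′` — from (1.21):
`lead·trail − 1 = lead(1 − V₀(∂p))trail + ((V′V₀)(∂p) − 1)`, `|lead|, |trail| ≤ 1`.
[cite: Balaban1985RegularSpaces, (1.26) p.79] -/
theorem ineq126 {V₀ V' : Site d → Fin d → 𝔸ˣ} (h₀ : ∀ y κ, V₀ y κ ∈ U1 𝔸) (h' : ∀ y κ, V' y κ ∈ U1 𝔸)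
    (μ ν : Fin d) (x : Site d) :
    ‖((covPlaq V₀ V' μ ν x : 𝔸ˣ) : 𝔸) - 1‖ ≤ ‖plaqF V₀ μ ν x - 1‖ + ‖plaqF (mulCfg V' V₀) μ ν x - 1‖ := by
  have hl : ‖((lead V₀ V' μ ν x : 𝔸ˣ) : 𝔸)‖ ≤ 1 := (lead_mem h₀ h' μ ν x).1
  have ht : ‖((trail V₀ V' μ ν x : 𝔸ˣ) : 𝔸)‖ ≤ 1 := (trail_mem h₀ h' μ ν x).1
  have key : ((covPlaq V₀ V' μ ν x : 𝔸ˣ) : 𝔸) - 1 =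
      ((lead V₀ V' μ ν x : 𝔸ˣ) : 𝔸) * (1 - plaqF V₀ μ ν x) * ((trail V₀ V' μ ν x : 𝔸ˣ) : 𝔸)
        + (plaqF (mulCfg V' V₀) μ ν x - 1) := by
    rw [eq121, covPlaq, Units.val_mul]
    noncomm_ring
  rw [key]
  refine (norm_add_le _ _).trans (add_le_add ?_ le_rfl)
  calc ‖((lead V₀ V' μ ν x : 𝔸ˣ) : 𝔸) * (1 - plaqF V₀ μ ν x) * ((trail V₀ V' μ ν x : 𝔸ˣ) : 𝔸)‖
      ≤ ‖((lead V₀ V' μ ν x : 𝔸ˣ) : 𝔸)‖ * ‖1 - plaqF V₀ μ ν x‖ * ‖((trail V₀ V' μ ν x : 𝔸ˣ) : 𝔸)‖ := norm_mul₃_le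
    _ ≤ 1 * ‖1 - plaqF V₀ μ ν x‖ * 1 :=
        mul_le_mul (mul_le_mul_of_nonneg_right hl (norm_nonneg _)) ht (norm_nonneg _) (by positivity)
    _ = ‖plaqF V₀ μ ν x - 1‖ := by rw [one_mul, mul_one, norm_sub_rev]

/-- «The first two terms on the right-hand side [of (1.43)] can be bounded by 4α₂α₀(Lʲη)⁻³η³»: with `|U₁ − 1| ≤ u`
on the bonds and `|U₀(∂p) − 1| ≤ p`, `|rem43(p)| ≤ 4up`. [cite: Balaban1985RegularSpaces, p.84 (first sentence)] -/
theorem norm_rem43_le {U₀ U₁ : Site d → Fin d → 𝔸ˣ} (h₀ : ∀ y κ, U₀ y κ ∈ U1 𝔸) (h₁ : ∀ y κ, U₁ y κ ∈ U1 𝔸)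
    {u : ℝ} (hu : ∀ y κ, ‖(U₁ y κ : 𝔸) - 1‖ ≤ u) {μ ν : Fin d} {x : Site d} {p : ℝ}
    (hP : ‖plaqF U₀ μ ν x - 1‖ ≤ p) : ‖rem43 U₀ U₁ μ ν x‖ ≤ 4 * u * p := by
  unfold rem43
  refine norm_two_terms_le ?_ ?_ (trail_mem h₀ h₁ μ ν x).1 hP
  · refine (norm_lead_sub_one_le (h₀ x μ) (h₁ x μ) ν).trans ?_
    have := hu x μ; have := hu (x + e μ) ν; linarith
  · refine (norm_trail_sub_one_le (h₀ x ν) (h₁ _ _) (h₁ _ _)).trans ?_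
    have := hu (x + e ν) μ; have := hu x ν; linarith

/-- The printed units: `u = α₂(Lʲη)⁻¹η`, `p = α₀η²(Lʲη)⁻²` give «4α₂α₀(Lʲη)⁻³η³».
[cite: Balaban1985RegularSpaces, p.84 (first sentence)] -/
theorem norm_rem43_le_printed {U₀ U₁ : Site d → Fin d → 𝔸ˣ} (h₀ : ∀ y κ, U₀ y κ ∈ U1 𝔸)
    (h₁ : ∀ y κ, U₁ y κ ∈ U1 𝔸) {L j : ℕ} {η α₀ α₂ : ℝ}
    (hu : ∀ y κ, ‖(U₁ y κ : 𝔸) - 1‖ ≤ α₂ * ((L : ℝ) ^ j * η)⁻¹ * η) {μ ν : Fin d} {x : Site d}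
    (hP : ‖plaqF U₀ μ ν x - 1‖ ≤ α₀ * η ^ 2 * (((L : ℝ) ^ j * η)⁻¹) ^ 2) :
    ‖rem43 U₀ U₁ μ ν x‖ ≤ 4 * α₂ * α₀ * (((L : ℝ) ^ j * η)⁻¹) ^ 3 * η ^ 3 := by
  refine (norm_rem43_le h₀ h₁ hu hP).trans_eq ?_
  ring

/-- `|R(w)Z − Z| ≤ 2|w − 1||Z|` for `w ∈ U1`: `R(w)Z − Z = ((w − 1)Z − Z(w − 1))w⁻¹`. [folklore] -/
theorem norm_conjR_sub_self_le {w : 𝔸ˣ} (hw : w ∈ U1 𝔸) (Z : 𝔸) :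
    ‖conjR w Z - Z‖ ≤ 2 * ‖(w : 𝔸) - 1‖ * ‖Z‖ := by
  have key : conjR w Z - Z = (((w : 𝔸) - 1) * Z - Z * ((w : 𝔸) - 1)) * ((w⁻¹ : 𝔸ˣ) : 𝔸) := by
    have h1 : (w : 𝔸) * ((w⁻¹ : 𝔸ˣ) : 𝔸) = 1 := Units.mul_inv w
    calc conjR w Z - Z = (w : 𝔸) * Z * ((w⁻¹ : 𝔸ˣ) : 𝔸) - Z * ((w : 𝔸) * ((w⁻¹ : 𝔸ˣ) : 𝔸)) := by
          rw [h1, mul_one, conjR_apply]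
      _ = (((w : 𝔸) - 1) * Z - Z * ((w : 𝔸) - 1)) * ((w⁻¹ : 𝔸ˣ) : 𝔸) := by noncomm_ring
  rw [key]
  calc ‖(((w : 𝔸) - 1) * Z - Z * ((w : 𝔸) - 1)) * ((w⁻¹ : 𝔸ˣ) : 𝔸)‖
      ≤ ‖((w : 𝔸) - 1) * Z - Z * ((w : 𝔸) - 1)‖ * ‖((w⁻¹ : 𝔸ˣ) : 𝔸)‖ := norm_mul_le _ _
    _ ≤ (‖(w : 𝔸) - 1‖ * ‖Z‖ + ‖Z‖ * ‖(w : 𝔸) - 1‖) * 1 :=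
        mul_le_mul ((norm_sub_le _ _).trans (add_le_add (norm_mul_le _ _) (norm_mul_le _ _))) hw.2
          (norm_nonneg _) (by positivity)
    _ = 2 * ‖(w : 𝔸) - 1‖ * ‖Z‖ := by ring

end Normed

/-! ## §3 The divergence (1.2) of a general plaquette function, the exact identity (1.45), (1.44) before estimation -/

section Divergence

variable {𝔸 : Type*} [NormedRing 𝔸] [NormedAlgebra ℂ 𝔸]

/-- **(1.2)** for a GENERAL plaquette function `F` (`F μ ν x = F(p_{μν}(x))`):
`(D^{η*}_U F)_μ(x) = Σ_{ν<μ}(D^{η*}_{U,ν}F_{νμ})(x) − Σ_{ν>μ}(D^{η*}_{U,ν}F_{μν})(x)`.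
[cite: Balaban1985RegularSpaces, (1.2) p.76] -/
def pdiv (η : ℝ) (V : Site d → Fin d → 𝔸ˣ) (F : Fin d → Fin d → Site d → 𝔸) (μ : Fin d) (x : Site d) : 𝔸 :=
  ∑ ν ∈ Finset.Iio μ, covDeriv η V ν (F ν μ) x - ∑ ν ∈ Finset.Ioi μ, covDeriv η V ν (F μ ν) x

/-- `D^{η*}_U ∂U = (D^{η*}_U F)|_{F = ∂U}`: the tree's `covDiv` is `pdiv` at the plaquette field. [folklore] -/
theorem pdiv_plaqF (η : ℝ) (V : Site d → Fin d → 𝔸ˣ) (μ : Fin d) (x : Site d) :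
    pdiv η V (plaqF V) μ x = covDiv η V μ x := rfl

/-- (1.1) is additive in `F`. [folklore] -/
theorem covDeriv_add (η : ℝ) (V : Site d → Fin d → 𝔸ˣ) (ν : Fin d) (F G : Site d → 𝔸) (x : Site d) :
    covDeriv η V ν (F + G) x = covDeriv η V ν F x + covDeriv η V ν G x := by
  simp only [covDeriv, Pi.add_apply, conjR_add, ← smul_add]
  congr 1
  abel

/-- Constants are covariantly constant: `D^{η*}_{U,ν}(F − 1) = D^{η*}_{U,ν}F` (`R(U)1 = 1`).
[cite: Balaban1985RegularSpaces, (1.45) p.84 (first equality)] -/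
theorem covDeriv_sub_one (η : ℝ) (V : Site d → Fin d → 𝔸ˣ) (ν : Fin d) (F : Site d → 𝔸) (x : Site d) :
    covDeriv η V ν (F - 1) x = covDeriv η V ν F x := by
  simp only [covDeriv, Pi.sub_apply, Pi.one_apply, conjR_sub, conjR_one, sub_sub_sub_cancel_right]

/-- (1.2) is additive in `F`. [folklore] -/
theorem pdiv_add (η : ℝ) (V : Site d → Fin d → 𝔸ˣ) (F G : Fin d → Fin d → Site d → 𝔸) (μ : Fin d)
    (x : Site d) : pdiv η V (F + G) μ x = pdiv η V F μ x + pdiv η V G μ x := by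
  simp only [pdiv, Pi.add_apply, covDeriv_add, Finset.sum_add_distrib]
  abel

/-- «(D^{η*}_{U₁U₀}∂_{U₀}U₁)(x, x + ηe_μ) = (D^{η*}_{U₁U₀}(∂_{U₀}U₁ − 1))(x, x + ηe_μ)»: `(D^{η*}_U(F − 1))_μ = (D^{η*}_U F)_μ`.
[cite: Balaban1985RegularSpaces, (1.45) p.84 (first equality)] -/
theorem pdiv_sub_one (η : ℝ) (V : Site d → Fin d → 𝔸ˣ) (F : Fin d → Fin d → Site d → 𝔸) (μ : Fin d)
    (x : Site d) : pdiv η V (F - 1) μ x = pdiv η V F μ x := by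
  simp only [pdiv, Pi.sub_apply, Pi.one_apply, covDeriv_sub_one]

/-- THE `ν`-TH CORRECTION TERM OF (1.45): `η⁻¹R(U₀(x, x − ηe_ν))·(R(U₁(x, x − ηe_ν)) − 1)(G(x − ηe_ν) − 1)` for a
function `G` of the plaquettes based at the sites, `U(x, x − e_ν) = U(x − e_ν, x)⁻¹`.
[cite: Balaban1985RegularSpaces, (1.45) p.84] -/
def corr (η : ℝ) (U₀ U₁ : Site d → Fin d → 𝔸ˣ) (ν : Fin d) (G : Site d → 𝔸) (x : Site d) : 𝔸 :=
  η⁻¹ • conjR (U₀ (x - e ν) ν)⁻¹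
    (conjR (U₁ (x - e ν) ν)⁻¹ (G (x - e ν) - 1) - (G (x - e ν) - 1))

/-- (1.45) one direction at a time: `D^{η*}_{U₁U₀,ν}G = D^{η*}_{U₀,ν}(G − 1) + corr_ν`, because
`R((U₁U₀)(x, x − e_ν)) = R(U₀(x − e_ν, x)⁻¹U₁(x − e_ν, x)⁻¹) = R(U₀(x, x − e_ν))R(U₁(x, x − e_ν))`.
[cite: Balaban1985RegularSpaces, (1.45) p.84] -/
theorem covDeriv_mulCfg (η : ℝ) (U₀ U₁ : Site d → Fin d → 𝔸ˣ) (ν : Fin d) (G : Site d → 𝔸) (x : Site d) :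
    covDeriv η (mulCfg U₁ U₀) ν G x = covDeriv η U₀ ν (G - 1) x + corr η U₀ U₁ ν G x := by
  have hinv : (mulCfg U₁ U₀ (x - e ν) ν)⁻¹ = (U₀ (x - e ν) ν)⁻¹ * (U₁ (x - e ν) ν)⁻¹ := by
    simp only [mulCfg, mul_inv_rev]
  simp only [covDeriv, corr, hinv, ← conjR_conjR, Pi.sub_apply, Pi.one_apply, conjR_sub, conjR_one, ← smul_add]
  congr 1
  abel

/-- **(1.45)**, EXACT, for every plaquette function `F`:
`(D^{η*}_{U₁U₀}F)_μ(x) = (D^{η*}_{U₀}(F − 1))_μ(x) + Σ_{ν<μ} corr_ν(F_{νμ}) − Σ_{ν>μ} corr_ν(F_{μν})`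
(print: `F = ∂_{U₀}U₁`). [cite: Balaban1985RegularSpaces, (1.45) p.84] -/
theorem eq145 (η : ℝ) (U₀ U₁ : Site d → Fin d → 𝔸ˣ) (F : Fin d → Fin d → Site d → 𝔸) (μ : Fin d)
    (x : Site d) :
    pdiv η (mulCfg U₁ U₀) F μ x = pdiv η U₀ (F - 1) μ x +
      (∑ ν ∈ Finset.Iio μ, corr η U₀ U₁ ν (F ν μ) x - ∑ ν ∈ Finset.Ioi μ, corr η U₀ U₁ ν (F μ ν) x) := by
  simp only [pdiv, covDeriv_mulCfg, Finset.sum_add_distrib, Pi.sub_apply, Pi.one_apply]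
  abel

/-- **(1.45)** verbatim (`F = ∂_{U₀}U₁`). [cite: Balaban1985RegularSpaces, (1.45) p.84] -/
theorem eq145_covPlaq (η : ℝ) (U₀ U₁ : Site d → Fin d → 𝔸ˣ) (μ : Fin d) (x : Site d) :
    pdiv η (mulCfg U₁ U₀) (covPlaqF U₀ U₁) μ x = pdiv η U₀ (covPlaqF U₀ U₁ - 1) μ x +
      (∑ ν ∈ Finset.Iio μ, corr η U₀ U₁ ν (covPlaqF U₀ U₁ ν μ) x -
        ∑ ν ∈ Finset.Ioi μ, corr η U₀ U₁ ν (covPlaqF U₀ U₁ μ ν) x) :=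
  eq145 η U₀ U₁ _ μ x

/-- **(1.44) as an exact identity** (before estimating): applying `D^{η*}_{U₁U₀}` to (1.43),
`D^{η*}_{U₁U₀}∂(U₁U₀) − D^{η*}_{U₀}∂U₀ − D^{η*}_{U₁U₀}∂_{U₀}U₁ = D^{η*}_{U₁U₀}(rem43) + (D^{η*}_{U₁U₀}∂U₀ − D^{η*}_{U₀}∂U₀)`.
[cite: Balaban1985RegularSpaces, (1.43)-(1.44) pp.83-84] -/
theorem eq144_identity (η : ℝ) (U₀ U₁ : Site d → Fin d → 𝔸ˣ) (μ : Fin d) (x : Site d) :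
    covDiv η (mulCfg U₁ U₀) μ x - covDiv η U₀ μ x - pdiv η (mulCfg U₁ U₀) (covPlaqF U₀ U₁) μ x =
      pdiv η (mulCfg U₁ U₀) (rem43 U₀ U₁) μ x +
        (pdiv η (mulCfg U₁ U₀) (plaqF U₀) μ x - covDiv η U₀ μ x) := by
  have h1 : covDiv η (mulCfg U₁ U₀) μ x = pdiv η (mulCfg U₁ U₀) (plaqF (mulCfg U₁ U₀) - 1) μ x := by
    rw [pdiv_sub_one, pdiv_plaqF]
  rw [h1, eq143_fun, pdiv_add, pdiv_add, pdiv_sub_one, pdiv_sub_one]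
  abel

/-- «D^{η*}_{U₁U₀}∂U₀ − D^{η*}_{U₀}∂U₀» is exactly the correction sum of (1.45) at `F = ∂U₀`.
[cite: Balaban1985RegularSpaces, p.84, (1.45)] -/
theorem pdiv_plaqF_sub_covDiv (η : ℝ) (U₀ U₁ : Site d → Fin d → 𝔸ˣ) (μ : Fin d) (x : Site d) :
    pdiv η (mulCfg U₁ U₀) (plaqF U₀) μ x - covDiv η U₀ μ x =
      ∑ ν ∈ Finset.Iio μ, corr η U₀ U₁ ν (plaqF U₀ ν μ) x -
        ∑ ν ∈ Finset.Ioi μ, corr η U₀ U₁ ν (plaqF U₀ μ ν) x := by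
  rw [eq145, pdiv_sub_one, pdiv_plaqF, add_sub_cancel_left]

end Divergence

/-! ## §4 The bounds `8d`, `2d`, `10d` of p. 84 / (1.44) -/

section Bounds

variable {𝔸 : Type*} [NormedRing 𝔸] [NormOneClass 𝔸] [NormedAlgebra ℂ 𝔸]

/-- `|(D^{η*}_{U,ν}G)(x)| ≤ η⁻¹(|G(x − e_ν)| + |G(x)|)` for a `U1`-valued bond variable (`|R(u)X| ≤ |X|`).
[folklore] -/
theorem norm_covDeriv_le {η : ℝ} (hη : 0 < η) {V : Site d → Fin d → 𝔸ˣ} {ν : Fin d} {x : Site d}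
    (hV : V (x - e ν) ν ∈ U1 𝔸) (G : Site d → 𝔸) :
    ‖covDeriv η V ν G x‖ ≤ η⁻¹ * (‖G (x - e ν)‖ + ‖G x‖) := by
  unfold covDeriv
  rw [norm_smul, Real.norm_of_nonneg (inv_nonneg.mpr hη.le)]
  refine mul_le_mul_of_nonneg_left ?_ (inv_nonneg.mpr hη.le)
  exact (norm_sub_le _ _).trans (add_le_add (norm_conjR_le ((U1 𝔸).inv_mem hV) _) le_rfl)

/-- `|corr_ν(G)(x)| ≤ η⁻¹ · 2|U₁(x − e_ν, x) − 1| · |G(x − e_ν) − 1|` for `U1`-valued bond variables.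
[cite: Balaban1985RegularSpaces, p.84 ("|D^{η*}_{U₁U₀}∂U₀ − D^{η*}_{U₀}∂U₀| < 2dα₀α₂(Lʲη)⁻³η²")] -/
theorem norm_corr_le {η : ℝ} (hη : 0 < η) {U₀ U₁ : Site d → Fin d → 𝔸ˣ} {ν : Fin d} {x : Site d}
    (h₀ : U₀ (x - e ν) ν ∈ U1 𝔸) (h₁ : U₁ (x - e ν) ν ∈ U1 𝔸) (G : Site d → 𝔸) :
    ‖corr η U₀ U₁ ν G x‖ ≤ η⁻¹ * (2 * ‖(U₁ (x - e ν) ν : 𝔸) - 1‖ * ‖G (x - e ν) - 1‖) := by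
  unfold corr
  rw [norm_smul, Real.norm_of_nonneg (inv_nonneg.mpr hη.le)]
  refine mul_le_mul_of_nonneg_left ?_ (inv_nonneg.mpr hη.le)
  refine (norm_conjR_le ((U1 𝔸).inv_mem h₀) _).trans ?_
  refine (norm_conjR_sub_self_le ((U1 𝔸).inv_mem h₁) _).trans ?_
  exact mul_le_mul_of_nonneg_right (mul_le_mul_of_nonneg_left (norm_inv_sub_one_le h₁) zero_le_two)
    (norm_nonneg _)

/-- «If we apply the derivative D^{η*}_{U₁U₀} … then the derivative of these two terms can be bounded by
8dα₂α₀(Lʲη)⁻³η²»: `|(D^{η*}_{U₁U₀} rem43)_μ(x)| ≤ 8(d − 1)η⁻¹up` (each of the `d − 1` directions contributes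
`η⁻¹(4up + 4up)`). [cite: Balaban1985RegularSpaces, p.84 (second sentence)] -/
theorem norm_pdiv_rem43_le {η : ℝ} (hη : 0 < η) {U₀ U₁ : Site d → Fin d → 𝔸ˣ} (h₀ : ∀ y κ, U₀ y κ ∈ U1 𝔸)
    (h₁ : ∀ y κ, U₁ y κ ∈ U1 𝔸) {u p : ℝ} (hu : ∀ y κ, ‖(U₁ y κ : 𝔸) - 1‖ ≤ u)
    (hp : ∀ (y : Site d) (κ ν : Fin d), κ ≠ ν → ‖plaqF U₀ κ ν y - 1‖ ≤ p) (μ : Fin d) (x : Site d) :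
    ‖pdiv η (mulCfg U₁ U₀) (rem43 U₀ U₁) μ x‖ ≤ 8 * ((d : ℝ) - 1) * η⁻¹ * u * p := by
  unfold pdiv
  calc _ ≤ ((d : ℝ) - 1) * (η⁻¹ * (4 * u * p + 4 * u * p)) := by
        refine norm_sub_sums_le (fun ν hν => ?_) (fun ν hν => ?_)
        · have hne : ν ≠ μ := (Finset.mem_Iio.mp hν).ne
          have hW : mulCfg U₁ U₀ (x - e ν) ν ∈ U1 𝔸 := mulCfg_mem h₀ h₁ (x - e ν) ν
          refine (norm_covDeriv_le hη hW (rem43 U₀ U₁ ν μ)).trans ?_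
          refine mul_le_mul_of_nonneg_left (add_le_add ?_ ?_) (inv_nonneg.mpr hη.le)
          · exact norm_rem43_le h₀ h₁ hu (hp (x - e ν) ν μ hne)
          · exact norm_rem43_le h₀ h₁ hu (hp x ν μ hne)
        · have hne : μ ≠ ν := (Finset.mem_Ioi.mp hν).ne
          have hW : mulCfg U₁ U₀ (x - e ν) ν ∈ U1 𝔸 := mulCfg_mem h₀ h₁ (x - e ν) ν
          refine (norm_covDeriv_le hη hW (rem43 U₀ U₁ μ ν)).trans ?_
          refine mul_le_mul_of_nonneg_left (add_le_add ?_ ?_) (inv_nonneg.mpr hη.le)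
          · exact norm_rem43_le h₀ h₁ hu (hp (x - e ν) μ ν hne)
          · exact norm_rem43_le h₀ h₁ hu (hp x μ ν hne)
    _ = 8 * ((d : ℝ) - 1) * η⁻¹ * u * p := by ring

/-- «Further we have |D^{η*}_{U₁U₀}∂U₀ − D^{η*}_{U₀}∂U₀| < 2dα₀α₂(Lʲη)⁻³η² on Ω_j»:
`|(D^{η*}_{U₁U₀}∂U₀)_μ(x) − (D^{η*}_{U₀}∂U₀)_μ(x)| ≤ 2(d − 1)η⁻¹up`, by (1.45) at `F = ∂U₀` and `|corr_ν| ≤ η⁻¹·2up`.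
[cite: Balaban1985RegularSpaces, p.84 (third sentence)] -/
theorem norm_pdiv_plaqF_sub_covDiv_le {η : ℝ} (hη : 0 < η) {U₀ U₁ : Site d → Fin d → 𝔸ˣ}
    (h₀ : ∀ y κ, U₀ y κ ∈ U1 𝔸) (h₁ : ∀ y κ, U₁ y κ ∈ U1 𝔸) {u p : ℝ} (hu : ∀ y κ, ‖(U₁ y κ : 𝔸) - 1‖ ≤ u)
    (hp : ∀ (y : Site d) (κ ν : Fin d), κ ≠ ν → ‖plaqF U₀ κ ν y - 1‖ ≤ p) (μ : Fin d) (x : Site d) :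
    ‖pdiv η (mulCfg U₁ U₀) (plaqF U₀) μ x - covDiv η U₀ μ x‖ ≤ 2 * ((d : ℝ) - 1) * η⁻¹ * u * p := by
  rw [pdiv_plaqF_sub_covDiv]
  have hu0 : 0 ≤ u := (norm_nonneg _).trans (hu x μ)
  have step : ∀ (ν κ κ' : Fin d) , κ ≠ κ' →
      ‖corr η U₀ U₁ ν (plaqF U₀ κ κ') x‖ ≤ η⁻¹ * (2 * u * p) := by
    intro ν κ κ' hne
    refine (norm_corr_le hη (h₀ (x - e ν) ν) (h₁ (x - e ν) ν) (plaqF U₀ κ κ')).trans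
      (mul_le_mul_of_nonneg_left ?_ (inv_nonneg.mpr hη.le))
    exact mul_le_mul (mul_le_mul_of_nonneg_left (hu (x - e ν) ν) zero_le_two) (hp (x - e ν) κ κ' hne)
      (norm_nonneg _) (mul_nonneg zero_le_two hu0)
  calc _ ≤ ((d : ℝ) - 1) * (η⁻¹ * (2 * u * p)) :=
        norm_sub_sums_le (fun ν hν => step ν ν μ (Finset.mem_Iio.mp hν).ne)
          (fun ν hν => step ν μ ν (Finset.mem_Ioi.mp hν).ne)
    _ = 2 * ((d : ℝ) - 1) * η⁻¹ * u * p := by ring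

/-- **(1.44)**: `D^{η*}_{U₁U₀}∂(U₁U₀) = D^{η*}_{U₀}∂U₀ + D^{η*}_{U₁U₀}∂_{U₀}U₁ + O₁(10(d − 1)η⁻¹up)` at every bond —
`8(d−1) + 2(d−1)`; print: `O₁(10dα₀α₂(Lʲη)⁻³η²)`. [cite: Balaban1985RegularSpaces, (1.44) p.84] -/
theorem eq144 {η : ℝ} (hη : 0 < η) {U₀ U₁ : Site d → Fin d → 𝔸ˣ} (h₀ : ∀ y κ, U₀ y κ ∈ U1 𝔸)
    (h₁ : ∀ y κ, U₁ y κ ∈ U1 𝔸) {u p : ℝ} (hu : ∀ y κ, ‖(U₁ y κ : 𝔸) - 1‖ ≤ u)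
    (hp : ∀ (y : Site d) (κ ν : Fin d), κ ≠ ν → ‖plaqF U₀ κ ν y - 1‖ ≤ p) (μ : Fin d) (x : Site d) :
    ‖covDiv η (mulCfg U₁ U₀) μ x - covDiv η U₀ μ x - pdiv η (mulCfg U₁ U₀) (covPlaqF U₀ U₁) μ x‖ ≤
      10 * ((d : ℝ) - 1) * η⁻¹ * u * p := by
  rw [eq144_identity]
  calc _ ≤ ‖pdiv η (mulCfg U₁ U₀) (rem43 U₀ U₁) μ x‖ +
        ‖pdiv η (mulCfg U₁ U₀) (plaqF U₀) μ x - covDiv η U₀ μ x‖ := norm_add_le _ _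
    _ ≤ 8 * ((d : ℝ) - 1) * η⁻¹ * u * p + 2 * ((d : ℝ) - 1) * η⁻¹ * u * p :=
        add_le_add (norm_pdiv_rem43_le hη h₀ h₁ hu hp μ x) (norm_pdiv_plaqF_sub_covDiv_le hη h₀ h₁ hu hp μ x)
    _ = 10 * ((d : ℝ) - 1) * η⁻¹ * u * p := by ring

/-- The unit bookkeeping of p. 84: `c(d − 1)η⁻¹·[α₂(Lʲη)⁻¹η]·[α₀η²(Lʲη)⁻²] ≤ c·d·α₀α₂(Lʲη)⁻³η²` for `c, α₀, α₂ ≥ 0`,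
`η > 0`. [folklore] -/
theorem units_p84 {c η r α₀ α₂ : ℝ} (hc : 0 ≤ c) (hη : 0 < η) (hr : 0 ≤ r) (hα₀ : 0 ≤ α₀) (hα₂ : 0 ≤ α₂)
    (d : ℕ) : c * ((d : ℝ) - 1) * η⁻¹ * (α₂ * r * η) * (α₀ * η ^ 2 * r ^ 2) ≤ c * d * α₀ * α₂ * r ^ 3 * η ^ 2 := by
  have h1 : η⁻¹ * η = 1 := inv_mul_cancel₀ hη.ne'
  have key : c * ((d : ℝ) - 1) * η⁻¹ * (α₂ * r * η) * (α₀ * η ^ 2 * r ^ 2) =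
      c * ((d : ℝ) - 1) * α₀ * α₂ * r ^ 3 * η ^ 2 := by
    calc c * ((d : ℝ) - 1) * η⁻¹ * (α₂ * r * η) * (α₀ * η ^ 2 * r ^ 2)
        = c * ((d : ℝ) - 1) * α₀ * α₂ * r ^ 3 * η ^ 2 * (η⁻¹ * η) := by ring
      _ = c * ((d : ℝ) - 1) * α₀ * α₂ * r ^ 3 * η ^ 2 := by rw [h1, mul_one]
  rw [key]
  have : 0 ≤ c * α₀ * α₂ * r ^ 3 * η ^ 2 := by positivity
  nlinarith

/-- «… the derivative of these two terms can be bounded by 8dα₂α₀(Lʲη)⁻³η²» in print's units.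
[cite: Balaban1985RegularSpaces, p.84 (second sentence)] -/
theorem norm_pdiv_rem43_le_printed {η : ℝ} (hη : 0 < η) {U₀ U₁ : Site d → Fin d → 𝔸ˣ}
    (h₀ : ∀ y κ, U₀ y κ ∈ U1 𝔸) (h₁ : ∀ y κ, U₁ y κ ∈ U1 𝔸) {L j : ℕ} {α₀ α₂ : ℝ} (hα₀ : 0 ≤ α₀)
    (hα₂ : 0 ≤ α₂) (hu : ∀ y κ, ‖(U₁ y κ : 𝔸) - 1‖ ≤ α₂ * ((L : ℝ) ^ j * η)⁻¹ * η)
    (hp : ∀ (y : Site d) (κ ν : Fin d), κ ≠ ν → ‖plaqF U₀ κ ν y - 1‖ ≤ α₀ * η ^ 2 * (((L : ℝ) ^ j * η)⁻¹) ^ 2)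
    (μ : Fin d) (x : Site d) :
    ‖pdiv η (mulCfg U₁ U₀) (rem43 U₀ U₁) μ x‖ ≤ 8 * d * α₀ * α₂ * (((L : ℝ) ^ j * η)⁻¹) ^ 3 * η ^ 2 :=
  (norm_pdiv_rem43_le hη h₀ h₁ hu hp μ x).trans
    (units_p84 (by norm_num) hη (inv_nonneg.mpr (by positivity)) hα₀ hα₂ d)

/-- «|D^{η*}_{U₁U₀}∂U₀ − D^{η*}_{U₀}∂U₀| < 2dα₀α₂(Lʲη)⁻³η²» in print's units.
[cite: Balaban1985RegularSpaces, p.84 (third sentence)] -/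
theorem norm_pdiv_plaqF_sub_covDiv_le_printed {η : ℝ} (hη : 0 < η) {U₀ U₁ : Site d → Fin d → 𝔸ˣ}
    (h₀ : ∀ y κ, U₀ y κ ∈ U1 𝔸) (h₁ : ∀ y κ, U₁ y κ ∈ U1 𝔸) {L j : ℕ} {α₀ α₂ : ℝ} (hα₀ : 0 ≤ α₀)
    (hα₂ : 0 ≤ α₂) (hu : ∀ y κ, ‖(U₁ y κ : 𝔸) - 1‖ ≤ α₂ * ((L : ℝ) ^ j * η)⁻¹ * η)
    (hp : ∀ (y : Site d) (κ ν : Fin d), κ ≠ ν → ‖plaqF U₀ κ ν y - 1‖ ≤ α₀ * η ^ 2 * (((L : ℝ) ^ j * η)⁻¹) ^ 2)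
    (μ : Fin d) (x : Site d) :
    ‖pdiv η (mulCfg U₁ U₀) (plaqF U₀) μ x - covDiv η U₀ μ x‖ ≤
      2 * d * α₀ * α₂ * (((L : ℝ) ^ j * η)⁻¹) ^ 3 * η ^ 2 :=
  (norm_pdiv_plaqF_sub_covDiv_le hη h₀ h₁ hu hp μ x).trans
    (units_p84 (by norm_num) hη (inv_nonneg.mpr (by positivity)) hα₀ hα₂ d)

/-- **(1.44)** in print's units: `D^{η*}_{U₁U₀}∂U₁U₀ = D^{η*}_{U₀}∂U₀ + D^{η*}_{U₁U₀}∂_{U₀}U₁ + O₁(10dα₀α₂(Lʲη)⁻³η²)`,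
for `U1`-valued `U₀, U₁` with `|U₁ − 1| ≤ α₂(Lʲη)⁻¹η` on the bonds and `|U₀(∂p) − 1| ≤ α₀η²(Lʲη)⁻²` on the
plaquettes (`α₀, α₂ ≥ 0`, `η > 0`). [cite: Balaban1985RegularSpaces, (1.44) p.84] -/
theorem eq144_printed {η : ℝ} (hη : 0 < η) {U₀ U₁ : Site d → Fin d → 𝔸ˣ} (h₀ : ∀ y κ, U₀ y κ ∈ U1 𝔸)
    (h₁ : ∀ y κ, U₁ y κ ∈ U1 𝔸) {L j : ℕ} {α₀ α₂ : ℝ} (hα₀ : 0 ≤ α₀) (hα₂ : 0 ≤ α₂)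
    (hu : ∀ y κ, ‖(U₁ y κ : 𝔸) - 1‖ ≤ α₂ * ((L : ℝ) ^ j * η)⁻¹ * η)
    (hp : ∀ (y : Site d) (κ ν : Fin d), κ ≠ ν → ‖plaqF U₀ κ ν y - 1‖ ≤ α₀ * η ^ 2 * (((L : ℝ) ^ j * η)⁻¹) ^ 2)
    (μ : Fin d) (x : Site d) :
    ‖covDiv η (mulCfg U₁ U₀) μ x - covDiv η U₀ μ x - pdiv η (mulCfg U₁ U₀) (covPlaqF U₀ U₁) μ x‖ ≤
      10 * d * α₀ * α₂ * (((L : ℝ) ^ j * η)⁻¹) ^ 3 * η ^ 2 :=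
  (eq144 hη h₀ h₁ hu hp μ x).trans (units_p84 (by norm_num) hη (inv_nonneg.mpr (by positivity)) hα₀ hα₂ d)

end Bounds

#print axioms hol_plaqWord_mulCfg
#print axioms eq143
#print axioms ineq126
#print axioms norm_rem43_le
#print axioms eq145
#print axioms eq144
#print axioms eq144_printed

end Literature.MathematicalPhysics.QuantumFieldTheory.Balaban1983to89.B8Eq143PlaqExpansion

end
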